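import Summits.QuantumFields.YangMills.Theorems.ColdStartUniversalityFeynmanKacSandwich
import HarnessLib

/-!
# Route `ColdStartUniversality` (fixed-cut-off package, sampler statistics): LEZAUD'S FORM BOUND — the quadratic form of the
# Feynman–Kac sandwich `g ↦ e^{εV/2} P(e^{εV/2} g)` under a spectral gap is at most `1 + ε²σ²/(gap − εb) + O(ε²)`

Helper file (seat `ym-line-csu-p1`, g37; `--supports stmt-QuantumFields-24809`).  ABSTRACT (no SZZ object), toolkit namespace
`…ColdStartUniversality.FeynmanKac`, sequel of `…FeynmanKacSandwich`.  If a symmetric Markov kernel `P` contracts variances in the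
form sense, `∫ G·PG dμ ≤ (∫G dμ)² + r·Var_μ(G)` (`r = e^{−λh}` for the time-`h` kernel of a reversible diffusion with `L²` gap `λ`), then
for the weight `w = e^{εV/2}` (`ε = θh`) the form of the sandwich is `∫ (wg)·P(wg) dμ ≤ r ∫ e^{εV} g² dμ + (1 − r)(∫ e^{εV/2} g dμ)²`, and:

* ★★★ `lezaud_form_bound` — for a probability measure `μ`, `V` measurable with `|V| ≤ b`, `∫ V dμ = 0`, `∫ V² dμ ≤ σ²` (`σ > 0`),
  `0 ≤ ε`, `εb ≤ 1`, `0 ≤ r ≤ 1` with `c := 1 − r − rεb > 0`, and EVERY bounded measurable `g`: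
  `r ∫ e^{εV} g² dμ + (1 − r)(∫ e^{εV/2} g dμ)² ≤ (1 + r²ε²σ²/c + r(εb)² + 3(1 − r)εb) · ∫ g² dμ`
  (second-order Taylor bounds for `e^{εV}`, Cauchy–Schwarz, and the completion of the square
  `2rε|∫g dμ|·|∫Vg dμ| − c·Var_μ(g) ≤ (r²ε²σ²/c)(∫ g dμ)²` — the quadratic-form version of Lezaud's bound on the top eigenvalue of
  `L + θV`, `Λ(θ) ≤ θ²σ²/(λ − θb)`);
* ★★ `lezaud_rate_bound` — with `r = e^{−λh}`, `ε = θh`, `0 ≤ θ`, `θb < λ` and `h` small (`λh ≤ 1`, `2λ²h ≤ λ − θb`):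
  `c > 0` and the constant is `≤ 1 + h·θ²σ²/(λ − θb) + h²·(2θ²σ²λ²/(λ − θb)² + θ²b² + 3λθb)`.

[cite: Lezaud2001, Theorem 1.1 and Remark 1.2 (proof, §4)].  THEOREMS ONLY, no definition, no sorry.  HONEST FRAMING: abstract real /
measure-theoretic bookkeeping for the fixed-cut-off sampler package; nothing is uniform in any cut-off; no crux, rung or summit statement
is proved; the Yang–Mills mass gap is NOT proved.
-/

set_option autoImplicit false

noncomputable section

namespace Summit.QuantumFields.YangMills.Theorems.ColdStartUniversality.FeynmanKac

open MeasureTheory ProbabilityTheory Filter Set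
open scoped BigOperators NNReal ENNReal

variable {X : Type*} [MeasurableSpace X]

/-! ## §1. Two Taylor bounds -/

omit [MeasurableSpace X] in
/-- `e^{y} ≤ 1 + y + B²` whenever `|y| ≤ B ≤ 1`. [folklore] -/
theorem exp_le_one_add_add_sq {y B : ℝ} (hy : |y| ≤ B) (hB : B ≤ 1) : Real.exp y ≤ 1 + y + B ^ 2 := by
  have h3 := Real.abs_exp_sub_one_sub_id_le (hy.trans hB)
  have h4 : y ^ 2 ≤ B ^ 2 := by
    have := pow_le_pow_left₀ (abs_nonneg _) hy 2; rwa [sq_abs] at this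
  linarith [(abs_le.1 h3).2]

omit [MeasurableSpace X] in
/-- `|e^{y/2} − 1| ≤ B` whenever `|y| ≤ B ≤ 1`. [folklore] -/
theorem abs_exp_half_sub_one_le {y B : ℝ} (hy : |y| ≤ B) (hB : B ≤ 1) : |Real.exp (y / 2) - 1| ≤ B := by
  have hB0 : 0 ≤ B := (abs_nonneg _).trans hy
  have hy2 : |y / 2| ≤ B / 2 := by rw [abs_div, abs_two]; linarith
  have h3 := Real.abs_exp_sub_one_sub_id_le (show |y / 2| ≤ 1 by linarith)
  have h4 : (y / 2) ^ 2 ≤ (B / 2) ^ 2 := by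
    have := pow_le_pow_left₀ (abs_nonneg _) hy2 2; rwa [sq_abs] at this
  calc |Real.exp (y / 2) - 1| = |(Real.exp (y / 2) - 1 - y / 2) + y / 2| := by ring_nf
    _ ≤ |Real.exp (y / 2) - 1 - y / 2| + |y / 2| := abs_add_le _ _
    _ ≤ (B / 2) ^ 2 + B / 2 := add_le_add (h3.trans h4) hy2
    _ ≤ B := by nlinarith

/-! ## §2. Lezaud's form bound -/

/-- ★★★ **LEZAUD'S FORM BOUND.**  On a probability space `(X, μ)` let `V` be measurable with `|V| ≤ b` (`b ≥ 0`), `∫ V dμ = 0` and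
`∫ V² dμ ≤ σ²` (`σ > 0`); let `0 ≤ ε` with `εb ≤ 1` and `0 ≤ r ≤ 1` with `c := 1 − r − r·εb > 0`.  Then for EVERY bounded measurable `g`

  `r ∫ e^{εV} g² dμ + (1 − r)(∫ e^{εV/2} g dμ)² ≤ (1 + r²ε²σ²/c + r(εb)² + 3(1 − r)(εb)) · ∫ g² dμ`.

With `r = e^{−λh}` (form-sense variance contraction of a reversible kernel with gap `λ`) and `ε = θh` the left side is the quadratic form
of the Feynman–Kac sandwich `g ↦ e^{θhV/2} κ_h(e^{θhV/2} g)`, and the constant is `1 + h·θ²σ²/(λ − θb) + O(h²)`: Lezaud's bound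
`Λ(θ) ≤ θ²σ²/(λ − θb)` on the top of the spectrum of `L + θV`, in quadratic-form clothing and without spectral theory.
[cite: Lezaud2001, Theorem 1.1 and Remark 1.2 (proof, §4)] -/
theorem lezaud_form_bound (μ : Measure X) [IsProbabilityMeasure μ] {V : X → ℝ} (hV : Measurable V) {b σ : ℝ} (hb : 0 ≤ b)
    (hVb : ∀ x, |V x| ≤ b) (hσ : 0 < σ) (hV0 : ∫ x, V x ∂μ = 0) (hV2 : ∫ x, V x ^ 2 ∂μ ≤ σ ^ 2)
    {ε r : ℝ} (hε : 0 ≤ ε) (hεb : ε * b ≤ 1) (hr0 : 0 ≤ r) (hr1 : r ≤ 1) (hc : 0 < 1 - r - r * (ε * b))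
    {g : X → ℝ} (hg : Measurable g) {C : ℝ} (hgC : ∀ x, |g x| ≤ C) :
    r * ∫ x, Real.exp (ε * V x) * g x ^ 2 ∂μ + (1 - r) * (∫ x, Real.exp (ε * V x / 2) * g x ∂μ) ^ 2 ≤
      (1 + r ^ 2 * ε ^ 2 * σ ^ 2 / (1 - r - r * (ε * b)) + r * (ε * b) ^ 2 + 3 * (1 - r) * (ε * b)) *
        ∫ x, g x ^ 2 ∂μ := by
  have hεb0 : 0 ≤ ε * b := mul_nonneg hε hb
  have hC0 : ∀ x, 0 ≤ C := fun x => (abs_nonneg _).trans (hgC x)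
  -- pointwise bounds on `εV`, the weights and their Taylor remainders
  have hεV : ∀ x, |ε * V x| ≤ ε * b := fun x => by
    rw [abs_mul, abs_of_nonneg hε]; exact mul_le_mul_of_nonneg_left (hVb x) hε
  have hexp : ∀ x, Real.exp (ε * V x) ≤ 1 + ε * V x + (ε * b) ^ 2 := fun x => exp_le_one_add_add_sq (hεV x) hεb
  have hexpb : ∀ x, |Real.exp (ε * V x)| ≤ Real.exp 1 := fun x => by
    rw [abs_of_pos (Real.exp_pos _)]
    exact Real.exp_le_exp.2 ((le_abs_self _).trans ((hεV x).trans hεb))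
  have hw1 : ∀ x, |Real.exp (ε * V x / 2) - 1| ≤ ε * b := fun x => abs_exp_half_sub_one_le (hεV x) hεb
  have hwb : ∀ x, |Real.exp (ε * V x / 2)| ≤ Real.exp 1 := fun x => by
    rw [abs_of_pos (Real.exp_pos _)]
    refine Real.exp_le_exp.2 ?_
    have := (le_abs_self _).trans ((hεV x).trans hεb)
    linarith [abs_nonneg (ε * V x), (abs_le.1 (hεV x)).1]
  -- measurability
  have hmexp : Measurable fun x => Real.exp (ε * V x) := Real.measurable_exp.comp (hV.const_mul ε)
  have hmw : Measurable fun x => Real.exp (ε * V x / 2) := Real.measurable_exp.comp ((hV.const_mul ε).div_const 2)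
  have hmw1 : Measurable fun x => Real.exp (ε * V x / 2) - 1 := hmw.sub measurable_const
  have hg2 : Measurable fun x => g x ^ 2 := hg.pow_const 2
  have hg2b : ∀ x, |g x ^ 2| ≤ C ^ 2 := fun x => by rw [abs_pow]; exact pow_le_pow_left₀ (abs_nonneg _) (hgC x) 2
  -- the moments of `g`
  set N : ℝ := ∫ x, g x ^ 2 ∂μ with hN
  set a : ℝ := ∫ x, g x ∂μ with ha
  have hN0 : 0 ≤ N := integral_nonneg fun x => sq_nonneg _
  have haN : a ^ 2 ≤ N := sq_integral_le_integral_sq μ hg hgC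
  have ig : Integrable g μ := integrable_of_measurable_of_abs_le μ hg hgC
  have ig2 : Integrable (fun x => g x ^ 2) μ := integrable_of_measurable_of_abs_le μ hg2 hg2b
  have iV : Integrable V μ := integrable_of_measurable_of_abs_le μ hV hVb
  have iVg : Integrable (fun x => V x * g x) μ := integrable_of_measurable_of_abs_le μ (hV.mul hg) (abs_mul_le_of_abs_le hVb hgC)
  have iVg2 : Integrable (fun x => V x * g x ^ 2) μ :=
    integrable_of_measurable_of_abs_le μ (hV.mul hg2) (abs_mul_le_of_abs_le hVb hg2b)
  -- the variance `S' = ∫ (g − a)² = N − a²`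
  have hS : ∫ x, (g x - a) ^ 2 ∂μ = N - a ^ 2 := by
    have hfun : (fun x => (g x - a) ^ 2) = fun x => (g x ^ 2 - (2 * a) * g x) + a ^ 2 := by funext x; ring
    have i12 : Integrable (fun x => g x ^ 2 - (2 * a) * g x) μ := ig2.sub (ig.const_mul _)
    rw [hfun, integral_add i12 (integrable_const _), integral_sub ig2 (ig.const_mul _), integral_const_mul, integral_const,
      probReal_univ, one_smul]
    rw [← ha, ← hN]; ring
  have hS0 : 0 ≤ N - a ^ 2 := by rw [← hS]; exact integral_nonneg fun x => sq_nonneg _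
  -- (i) `∫ e^{εV} g² ≤ N + ε ∫ V g² + (εb)² N`
  have hI1 : ∫ x, Real.exp (ε * V x) * g x ^ 2 ∂μ ≤ N + ε * ∫ x, V x * g x ^ 2 ∂μ + (ε * b) ^ 2 * N := by
    have hle : ∀ x, Real.exp (ε * V x) * g x ^ 2 ≤ (g x ^ 2 + ε * (V x * g x ^ 2)) + (ε * b) ^ 2 * g x ^ 2 := fun x => by
      have := mul_le_mul_of_nonneg_right (hexp x) (sq_nonneg (g x)); linarith
    have iL : Integrable (fun x => Real.exp (ε * V x) * g x ^ 2) μ :=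
      integrable_of_measurable_of_abs_le μ (hmexp.mul hg2) (abs_mul_le_of_abs_le hexpb hg2b)
    have i12 : Integrable (fun x => g x ^ 2 + ε * (V x * g x ^ 2)) μ := ig2.add (iVg2.const_mul _)
    have i123 : Integrable (fun x => (g x ^ 2 + ε * (V x * g x ^ 2)) + (ε * b) ^ 2 * g x ^ 2) μ := i12.add (ig2.const_mul _)
    have h := integral_mono iL i123 hle
    rw [integral_add i12 (ig2.const_mul _), integral_add ig2 (iVg2.const_mul _), integral_const_mul, integral_const_mul] at h
    simpa [hN] using h
  -- (ii) `(∫ e^{εV/2} g)² ≤ a² + 3 εb N`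
  set y : ℝ := ∫ x, (Real.exp (ε * V x / 2) - 1) * g x ∂μ with hy
  have iw1g : Integrable (fun x => (Real.exp (ε * V x / 2) - 1) * g x) μ :=
    integrable_of_measurable_of_abs_le μ (hmw1.mul hg) (abs_mul_le_of_abs_le hw1 hgC)
  have hsplit : ∫ x, Real.exp (ε * V x / 2) * g x ∂μ = a + y := by
    have hfun : (fun x => Real.exp (ε * V x / 2) * g x) = fun x => g x + (Real.exp (ε * V x / 2) - 1) * g x := by
      funext x; ring
    rw [hfun, integral_add ig iw1g]
  have hy2 : y ^ 2 ≤ (ε * b) ^ 2 * N := by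
    have h := sq_integral_mul_le μ hmw1 hw1 hg hgC
    have h2 : ∫ x, (Real.exp (ε * V x / 2) - 1) ^ 2 ∂μ ≤ (ε * b) ^ 2 := by
      have hpt : ∀ x, (Real.exp (ε * V x / 2) - 1) ^ 2 ≤ (ε * b) ^ 2 := fun x => by
        have := pow_le_pow_left₀ (abs_nonneg _) (hw1 x) 2; rwa [sq_abs] at this
      have i1 : Integrable (fun x => (Real.exp (ε * V x / 2) - 1) ^ 2) μ :=
        integrable_of_measurable_of_abs_le μ (hmw1.pow_const 2) (B := (ε * b) ^ 2) fun x => by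
          rw [abs_of_nonneg (sq_nonneg _)]; exact hpt x
      have := integral_mono i1 (integrable_const ((ε * b) ^ 2)) hpt
      rwa [integral_const, probReal_univ, one_smul] at this
    exact h.trans (mul_le_mul_of_nonneg_right h2 hN0)
  have hay : |a * y| ≤ ε * b * N := by
    refine abs_le_of_sq_le_sq ?_ (by positivity)
    calc (a * y) ^ 2 = a ^ 2 * y ^ 2 := by ring
      _ ≤ N * ((ε * b) ^ 2 * N) := mul_le_mul haN hy2 (sq_nonneg _) hN0
      _ = (ε * b * N) ^ 2 := by ring
  have hI2 : (∫ x, Real.exp (ε * V x / 2) * g x ∂μ) ^ 2 ≤ a ^ 2 + 3 * (ε * b) * N := by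
    rw [hsplit]
    have heb : (ε * b) ^ 2 ≤ ε * b := by nlinarith
    have hebN : (ε * b) ^ 2 * N ≤ (ε * b) * N := mul_le_mul_of_nonneg_right heb hN0
    have hay' : a * y ≤ ε * b * N := (le_abs_self _).trans hay
    calc (a + y) ^ 2 = a ^ 2 + 2 * (a * y) + y ^ 2 := by ring
      _ ≤ a ^ 2 + 2 * (ε * b * N) + (ε * b) * N := by linarith
      _ = a ^ 2 + 3 * (ε * b) * N := by ring
  -- (iii) `∫ V g² = 2 a z + ∫ V (g − a)²`, `z = ∫ V g`, with `z² ≤ σ² S'` and `∫ V (g − a)² ≤ b S'`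
  set z : ℝ := ∫ x, V x * g x ∂μ with hz
  have hga : Measurable fun x => g x - a := hg.sub measurable_const
  have hgab : ∀ x, |g x - a| ≤ C + |a| := fun x => (abs_sub _ _).trans (add_le_add (hgC x) le_rfl)
  have hga2 : Measurable fun x => (g x - a) ^ 2 := hga.pow_const 2
  have hga2b : ∀ x, |(g x - a) ^ 2| ≤ (C + |a|) ^ 2 := fun x => by
    rw [abs_pow]; exact pow_le_pow_left₀ (abs_nonneg _) (hgab x) 2
  have iVga2 : Integrable (fun x => V x * (g x - a) ^ 2) μ :=
    integrable_of_measurable_of_abs_le μ (hV.mul hga2) (abs_mul_le_of_abs_le hVb hga2b)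
  have hVg2 : ∫ x, V x * g x ^ 2 ∂μ = 2 * a * z + ∫ x, V x * (g x - a) ^ 2 ∂μ := by
    have hfun : (fun x => V x * (g x - a) ^ 2) = fun x => (V x * g x ^ 2 - (2 * a) * (V x * g x)) + a ^ 2 * V x := by
      funext x; ring
    have i12 : Integrable (fun x => V x * g x ^ 2 - (2 * a) * (V x * g x)) μ := iVg2.sub (iVg.const_mul _)
    rw [hfun, integral_add i12 (iV.const_mul _), integral_sub iVg2 (iVg.const_mul _), integral_const_mul, integral_const_mul, hV0,
      ← hz]
    ring
  have hz2 : z ^ 2 ≤ σ ^ 2 * (N - a ^ 2) := by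
    have hz' : z = ∫ x, V x * (g x - a) ∂μ := by
      have hfun : (fun x => V x * (g x - a)) = fun x => V x * g x - a * V x := by funext x; ring
      rw [hfun, integral_sub iVg (iV.const_mul _), integral_const_mul, hV0, mul_zero, sub_zero]
    rw [hz']
    have h := sq_integral_mul_le μ hV hVb hga hgab
    rw [hS] at h
    exact h.trans (mul_le_mul_of_nonneg_right hV2 hS0)
  have hVS : ∫ x, V x * (g x - a) ^ 2 ∂μ ≤ b * (N - a ^ 2) := by
    rw [← hS, ← integral_const_mul]
    exact integral_mono iVga2 ((integrable_of_measurable_of_abs_le μ hga2 hga2b).const_mul b)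
      fun x => mul_le_mul_of_nonneg_right ((le_abs_self _).trans (hVb x)) (sq_nonneg _)
  -- (iv) completion of the square: `2 r ε |a| |z| ≤ c S' + (r²ε²σ²/c) a²`
  set c : ℝ := 1 - r - r * (ε * b) with hcdef
  set S' : ℝ := N - a ^ 2 with hS'
  have hzS : z ^ 2 / σ ^ 2 ≤ S' := by
    rw [div_le_iff₀ (by positivity)]; linarith [hz2]
  have hAMGM : 2 * r * ε * (|a| * |z|) ≤ c * S' + (r ^ 2 * ε ^ 2 * σ ^ 2 / c) * a ^ 2 := by
    have hmul : c * (2 * r * ε * (|a| * |z|)) ≤ c * (c * S' + (r ^ 2 * ε ^ 2 * σ ^ 2 / c) * a ^ 2) := by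
      have h := sq_nonneg (c * |z| / σ - r * ε * |a| * σ)
      have e : (c * |z| / σ - r * ε * |a| * σ) ^ 2 =
          c * c * (|z| ^ 2 / σ ^ 2) - 2 * c * r * ε * (|a| * |z|) + r ^ 2 * ε ^ 2 * |a| ^ 2 * σ ^ 2 := by
        field_simp; ring
      rw [e, sq_abs, sq_abs] at h
      have e2 : c * (c * S' + r ^ 2 * ε ^ 2 * σ ^ 2 / c * a ^ 2) = c * c * S' + r ^ 2 * ε ^ 2 * σ ^ 2 * a ^ 2 := by
        field_simp
      rw [e2]
      have h3 : c * c * (z ^ 2 / σ ^ 2) ≤ c * c * S' := mul_le_mul_of_nonneg_left hzS (mul_nonneg hc.le hc.le)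
      linarith
    exact le_of_mul_le_mul_left hmul hc
  have hK0 : 0 ≤ r ^ 2 * ε ^ 2 * σ ^ 2 / c := by positivity
  have hKa : (r ^ 2 * ε ^ 2 * σ ^ 2 / c) * a ^ 2 ≤ (r ^ 2 * ε ^ 2 * σ ^ 2 / c) * N := mul_le_mul_of_nonneg_left haN hK0
  -- (v) assembly
  have haz : a * z ≤ |a| * |z| := by rw [← abs_mul]; exact le_abs_self _
  have hεVg2 : ε * ∫ x, V x * g x ^ 2 ∂μ ≤ 2 * ε * (|a| * |z|) + ε * (b * S') := by
    rw [hVg2]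
    have h1 : ε * (2 * a * z) ≤ ε * (2 * (|a| * |z|)) := mul_le_mul_of_nonneg_left (by linarith) hε
    have h2 : ε * ∫ x, V x * (g x - a) ^ 2 ∂μ ≤ ε * (b * S') := mul_le_mul_of_nonneg_left hVS hε
    linarith
  have hQ1 : r * ∫ x, Real.exp (ε * V x) * g x ^ 2 ∂μ ≤ r * (N + (2 * ε * (|a| * |z|) + ε * (b * S')) + (ε * b) ^ 2 * N) :=
    mul_le_mul_of_nonneg_left (by linarith) hr0
  have hQ2 : (1 - r) * (∫ x, Real.exp (ε * V x / 2) * g x ∂μ) ^ 2 ≤ (1 - r) * (a ^ 2 + 3 * (ε * b) * N) :=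
    mul_le_mul_of_nonneg_left hI2 (by linarith)
  have hcS : r * N + (1 - r) * a ^ 2 + r * (ε * (b * S')) = N - c * S' := by rw [hcdef, hS']; ring
  calc r * ∫ x, Real.exp (ε * V x) * g x ^ 2 ∂μ + (1 - r) * (∫ x, Real.exp (ε * V x / 2) * g x ∂μ) ^ 2
      ≤ r * (N + (2 * ε * (|a| * |z|) + ε * (b * S')) + (ε * b) ^ 2 * N) + (1 - r) * (a ^ 2 + 3 * (ε * b) * N) :=
        add_le_add hQ1 hQ2
    _ = (N - c * S') + 2 * r * ε * (|a| * |z|) + (r * (ε * b) ^ 2 + 3 * (1 - r) * (ε * b)) * N := by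
        rw [← hcS]; ring
    _ ≤ (N - c * S') + (c * S' + (r ^ 2 * ε ^ 2 * σ ^ 2 / c) * N) + (r * (ε * b) ^ 2 + 3 * (1 - r) * (ε * b)) * N := by
        linarith [hAMGM, hKa]
    _ = (1 + r ^ 2 * ε ^ 2 * σ ^ 2 / c + r * (ε * b) ^ 2 + 3 * (1 - r) * (ε * b)) * N := by ring

/-! ## §3. The constant at `r = e^{−λh}`, `ε = θh`: `1 + h·θ²σ²/(λ − θb) + O(h²)` -/

omit [MeasurableSpace X] in
/-- ★★ **The rate bound.**  With `r = e^{−λh}`, `ε = θh`, `0 < λ`, `0 ≤ θ`, `0 ≤ b`, `θb < λ`, `0 < h` and the smallness conditions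
`λh ≤ 1`, `2λ²h ≤ λ − θb`:  `c = 1 − r − r·εb > 0` and
`1 + r²ε²σ²/c + r(εb)² + 3(1 − r)εb ≤ 1 + h·θ²σ²/(λ − θb) + h²·(2θ²σ²λ²/(λ − θb)² + θ²b² + 3λθb)`
(`1 − r ≤ λh`, `1 − r ≥ λh − λ²h²`, `1/(λ − θb − λ²h) ≤ 1/(λ − θb) + 2λ²h/(λ − θb)²`).  The coefficient of `h`, `θ²σ²/(λ − θb)`, is
Lezaud's bound for the top of the spectrum of `L + θV`. [cite: Lezaud2001, Theorem 1.1 and Remark 1.2] -/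
theorem lezaud_rate_bound {lam θ b σ h : ℝ} (hlam : 0 < lam) (hθ : 0 ≤ θ) (hb : 0 ≤ b) (hθb : θ * b < lam) (hh : 0 < h)
    (h1 : lam * h ≤ 1) (h3 : 2 * lam ^ 2 * h ≤ lam - θ * b) :
    0 < 1 - Real.exp (-(lam * h)) - Real.exp (-(lam * h)) * (θ * h * b) ∧
      1 + Real.exp (-(lam * h)) ^ 2 * (θ * h) ^ 2 * σ ^ 2 / (1 - Real.exp (-(lam * h)) - Real.exp (-(lam * h)) * (θ * h * b)) +
          Real.exp (-(lam * h)) * (θ * h * b) ^ 2 + 3 * (1 - Real.exp (-(lam * h))) * (θ * h * b) ≤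
        1 + h * (θ ^ 2 * σ ^ 2 / (lam - θ * b)) +
          h ^ 2 * (2 * θ ^ 2 * σ ^ 2 * lam ^ 2 / (lam - θ * b) ^ 2 + θ ^ 2 * b ^ 2 + 3 * lam * θ * b) := by
  set r : ℝ := Real.exp (-(lam * h)) with hr
  have hr0 : 0 < r := Real.exp_pos _
  have hr1 : r ≤ 1 := by rw [hr]; exact Real.exp_le_one_iff.2 (by nlinarith)
  have hd : 0 < lam - θ * b := by linarith
  -- `1 − r ≤ λh` and `1 − r ≥ λh − λ²h²`
  have h1r : 1 - r ≤ lam * h := by have := Real.add_one_le_exp (-(lam * h)); rw [← hr] at this; linarith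
  have h1r' : lam * h - lam ^ 2 * h ^ 2 ≤ 1 - r := by
    have habs : |-(lam * h)| ≤ 1 := by rw [abs_neg, abs_of_nonneg (by positivity)]; exact h1
    have := Real.abs_exp_sub_one_sub_id_le habs
    rw [← hr] at this
    have e : (-(lam * h)) ^ 2 = lam ^ 2 * h ^ 2 := by ring
    linarith [(abs_le.1 this).2]
  -- the denominator `c ≥ h (λ − θb − λ²h) ≥ h (λ − θb)/2 > 0`
  have hθhb : 0 ≤ θ * h * b := by positivity
  have hrεb : r * (θ * h * b) ≤ θ * h * b := by nlinarith
  have hc : h * (lam - θ * b - lam ^ 2 * h) ≤ 1 - r - r * (θ * h * b) := by nlinarith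
  have hd2 : (lam - θ * b) / 2 ≤ lam - θ * b - lam ^ 2 * h := by linarith
  have hd2pos : 0 < lam - θ * b - lam ^ 2 * h := by linarith
  have hcpos : 0 < 1 - r - r * (θ * h * b) := lt_of_lt_of_le (mul_pos hh hd2pos) hc
  refine ⟨hcpos, ?_⟩
  -- main term
  have hmain : r ^ 2 * (θ * h) ^ 2 * σ ^ 2 / (1 - r - r * (θ * h * b)) ≤
      h * (θ ^ 2 * σ ^ 2 / (lam - θ * b)) + h ^ 2 * (2 * θ ^ 2 * σ ^ 2 * lam ^ 2 / (lam - θ * b) ^ 2) := by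
    have hr2 : r ^ 2 ≤ 1 := by nlinarith
    have s1 : r ^ 2 * (θ * h) ^ 2 * σ ^ 2 / (1 - r - r * (θ * h * b)) ≤ (θ * h) ^ 2 * σ ^ 2 / (h * (lam - θ * b - lam ^ 2 * h)) := by
      have hnum : r ^ 2 * (θ * h) ^ 2 * σ ^ 2 ≤ (θ * h) ^ 2 * σ ^ 2 := by
        have : 0 ≤ (θ * h) ^ 2 * σ ^ 2 := by positivity
        nlinarith
      exact div_le_div₀ (by positivity) hnum (mul_pos hh hd2pos) hc
    have s2 : (θ * h) ^ 2 * σ ^ 2 / (h * (lam - θ * b - lam ^ 2 * h)) = h * (θ ^ 2 * σ ^ 2 / (lam - θ * b - lam ^ 2 * h)) := by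
      field_simp
    -- `1/(d − x) ≤ 1/d + 2x/d²` for `x = λ²h ≤ d/2`
    have s3 : θ ^ 2 * σ ^ 2 / (lam - θ * b - lam ^ 2 * h) ≤
        θ ^ 2 * σ ^ 2 / (lam - θ * b) + h * (2 * θ ^ 2 * σ ^ 2 * lam ^ 2 / (lam - θ * b) ^ 2) := by
      have hA : 0 ≤ θ ^ 2 * σ ^ 2 := by positivity
      have hx : 0 ≤ lam ^ 2 * h := by positivity
      have hx2 : 0 ≤ (lam - θ * b) - 2 * (lam ^ 2 * h) := by linarith
      -- `1/(d − x) ≤ 1/d + 2x/d²` for `0 ≤ x ≤ d/2`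
      have key : 1 / (lam - θ * b - lam ^ 2 * h) ≤ 1 / (lam - θ * b) + 2 * (lam ^ 2 * h) / (lam - θ * b) ^ 2 := by
        rw [div_add_div _ _ hd.ne' (pow_ne_zero 2 hd.ne'), div_le_div_iff₀ hd2pos (by positivity)]
        have hp := mul_nonneg (mul_nonneg hx hd.le) hx2
        nlinarith [hp]
      calc θ ^ 2 * σ ^ 2 / (lam - θ * b - lam ^ 2 * h) = θ ^ 2 * σ ^ 2 * (1 / (lam - θ * b - lam ^ 2 * h)) := by
            rw [mul_one_div]
        _ ≤ θ ^ 2 * σ ^ 2 * (1 / (lam - θ * b) + 2 * (lam ^ 2 * h) / (lam - θ * b) ^ 2) := mul_le_mul_of_nonneg_left key hA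
        _ = θ ^ 2 * σ ^ 2 / (lam - θ * b) + h * (2 * θ ^ 2 * σ ^ 2 * lam ^ 2 / (lam - θ * b) ^ 2) := by ring
    calc r ^ 2 * (θ * h) ^ 2 * σ ^ 2 / (1 - r - r * (θ * h * b))
        ≤ h * (θ ^ 2 * σ ^ 2 / (lam - θ * b - lam ^ 2 * h)) := s1.trans_eq s2
      _ ≤ h * (θ ^ 2 * σ ^ 2 / (lam - θ * b) + h * (2 * θ ^ 2 * σ ^ 2 * lam ^ 2 / (lam - θ * b) ^ 2)) :=
          mul_le_mul_of_nonneg_left s3 hh.le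
      _ = h * (θ ^ 2 * σ ^ 2 / (lam - θ * b)) + h ^ 2 * (2 * θ ^ 2 * σ ^ 2 * lam ^ 2 / (lam - θ * b) ^ 2) := by ring
  -- the two remainder terms
  have hrem1 : r * (θ * h * b) ^ 2 ≤ h ^ 2 * (θ ^ 2 * b ^ 2) := by
    have : (θ * h * b) ^ 2 = h ^ 2 * (θ ^ 2 * b ^ 2) := by ring
    rw [this]; nlinarith [sq_nonneg (θ * b)]
  have hrem2 : 3 * (1 - r) * (θ * h * b) ≤ h ^ 2 * (3 * lam * θ * b) := by
    have : h ^ 2 * (3 * lam * θ * b) = 3 * (lam * h) * (θ * h * b) := by ring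
    rw [this]
    exact mul_le_mul_of_nonneg_right (by linarith) hθhb
  have hsplit : h ^ 2 * (2 * θ ^ 2 * σ ^ 2 * lam ^ 2 / (lam - θ * b) ^ 2 + θ ^ 2 * b ^ 2 + 3 * lam * θ * b) =
      h ^ 2 * (2 * θ ^ 2 * σ ^ 2 * lam ^ 2 / (lam - θ * b) ^ 2) + h ^ 2 * (θ ^ 2 * b ^ 2) + h ^ 2 * (3 * lam * θ * b) := by ring
  rw [hsplit]
  linarith [hmain, hrem1, hrem2]

end Summit.QuantumFields.YangMills.Theorems.ColdStartUniversality.FeynmanKac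

end
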